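import Literature.NumberTheory.LocalFields.UnramifiedNormLevelSurjective            -- ★ `exists_sub_one_mem_and_mul_map_eq_of_le_maximalIdeal` (level `J`), brings ★ `exists_mul_galAdicCompletionMap_eq_of_inert` (level 0)
import Literature.NumberTheory.Automorphic.SplitTorusOrderFixedSidePlace             -- ★ `exists_isUnit_galAdicCompletionMap_sub` (`σ_w` moves an integer by a unit, inert unramified)
import Literature.NumberTheory.Automorphic.AnisotropicUnitaryGroupCompactOfPlace      -- ★ `conjLocal_apply_eq_of_smul_eq`
import Literature.NumberTheory.Weil1982.UnitaryFinTopFormHyperspecialDensitySplit     -- ★ `smul_galInv_ne` (+ ★ D1: `localIntegers`, `twoP`, ★ Cayley window `valued_resChar_apply_lt_one`, `mem_integer_iff_valued_le_one`)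
import Literature.NumberTheory.Weil1982.UnitaryFinTopFormRankOneSanitySplit          -- ★ `valued_two_eq_one_of_not_mem`, `valued_conjLocal_apply_self`
import Literature.NumberTheory.Weil1982.UnitaryFinTopFormDualLattice                 -- ★ `conjLocal_mem_localIntegers`
import Literature.NumberTheory.Automorphic.ValuedFieldValuativeRelBridge              -- ★ `v_eq_one_iff_valuation_eq_one` (`Valued.v` vs `ValuativeRel.valuation`)
import HarnessLib

/-!
# K2 ∕ E5 «TamagawaUnitary», unit H (QUAT-LOCAL) — helper `K2E5QuatLocalNormSurjective`: the UNRAMIFIED LOCAL NORM IS ONTO THE UNITS, in the `E_v = Π_{w∣v} L_w` currency,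
# at level `0` and at level `2p` (Serre, *Local Fields* V §2 Prop. 3; inert places by ★ `UnramifiedQuadraticNorm`, split pairs by an orientation)

Cell `hodgecm-mathlib` (Track B «K2-LIT»), floor 0, item h413 = `stmt-HodgeConjecture-24833`; tier-1 socket module `Cruxes/H413/Lines/K2_E5_TamagawaUnitary_QuatLocal.lean`
(K2E5-plan (g0), sha16 0816239b3d4cc124), socket H3 `sig_K2E5QuatLocalGoodPlaceDensity` (p19).  PROOF lane, helper file (`--supports stmt-HodgeConjecture-24833 --as helper`);
author K2E5-p19 (g0).  Road of record for H3 (K2/STATUS.md 2026-09-03T23:0xZ): `ρ^D_v = ρ^{SU}_v · ρ^{GL₁∕L⁺}_v` along `1 → SL₁(D_h) → D_h^× →Nrd (L⁺)^× → 1`; the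
group-side surjectivity of `Nrd = det` on the integral levels needs, place by place over `v`, that a `c ⊗ 1`-FIXED integral unit `u ∈ 𝒪_{E_v}` (resp. one with `u ≡ 1 (2p)`)
is a NORM `λ · (c ⊗ 1)λ` of an integral unit `λ` (resp. of a `λ ≡ 1 (2p)`).  THIS FILE proves exactly that (`v` unramified in `L`):

* `exists_mul_conjLocal_eq_of_valued_eq_one` (LEVEL 0) and `exists_mul_conjLocal_eq_of_level` (LEVEL `2p`).  At a place `w ∣ v` FIXED by `c` (inert) the factor `λ_w` is supplied by
  ★ `UnramifiedQuadraticNorm.exists_mul_galAdicCompletionMap_eq_of_inert` (Serre V §2 Cor.: finite residue field) resp. ★ `exists_sub_one_mem_and_mul_map_eq_of_le_maximalIdeal` (Serre V §2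
  Prop. 3 a) at the ideal `J = 2p·𝒪_w ≤ 𝓂_w`, with ★ `exists_isUnit_galAdicCompletionMap_sub` for the trace-one element); at a SPLIT pair `{w, c⁻¹w}` one puts `λ = u` on one member and
  `λ = 1` on the other (an orientation `f : PlacesOver ↪ ℕ`), using `((c ⊗ 1)λ)_w = σ(λ_{c⁻¹w})` (★ `conjLocal_apply`).

HONEST LABEL: HC_CM is proved only modulo the 7 printed citations (2 remaining named inputs: hLiu418 = stmt-HodgeConjecture-24832,
h413 = stmt-HodgeConjecture-24833) until rung 0 closes; this helper closes no socket and changes no count.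

## References
* [Serre1979] J.-P. Serre, *Local Fields*, GTM 67 (1979) — Ch. V §2 Prop. 3, Corollary and Remark 1 (`N(U_L^n) = U_K^n`, `U_K = N U_L` for unramified `L∕K` with finite residue field).
* [PlatonovRapinchuk1994] V. Platonov, A. Rapinchuk, *Algebraic Groups and Number Theory* (1994) — §5.1 (`E ⊗ F_v = Π_{w∣v} E_w`, split vs inert places).
-/

set_option autoImplicit false
set_option linter.dupNamespace false

noncomputable section

namespace Summit.HodgeConjecture.HodgeConjecture.Cruxes.H413.K2E5QuatLocalNormSurjective

open NumberField IsDedekindDomain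
open Literature.NumberTheory.Automorphic Literature.NumberTheory.Automorphic.UnitaryGroup
open Literature.NumberTheory.Weil1982.UnitaryFinTopForm
open ValuativeRel

variable (L : Type) [Field L] [NumberField L] [IsCMField L] (v : HeightOneSpectrum (𝓞 ↥(maximalRealSubfield L)))

/-! ## §1 The inert factor: Serre V §2 at a `c`-fixed place, in the currency of `E_v` -/

/-- **LEVEL 0 at an inert place**: a `σ_w`-fixed `u_w ∈ 𝒪_w^×` is `s · σ_w s` with `s ∈ 𝒪_w^×` (★ `exists_mul_galAdicCompletionMap_eq_of_inert`; `|s|_w = 1` from `|s|² = |u| = 1`,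
`σ_w` being an isometry). [cite: Serre1979, Ch. V §2 Corollary and Remark 1] -/
theorem exists_mul_gal_eq_of_inert (hv : Algebra.IsUnramifiedIn (𝓞 L) v.asIdeal) (w : PlacesOver L v) (hw : IsCMField.complexConj L • w.1 = w.1)
    {u : w.1.adicCompletion L} (hu : Valued.v u = 1) (hσu : galAdicCompletionMap (L := L) (IsCMField.complexConj L) hw u = u) :
    ∃ s : w.1.adicCompletion L, Valued.v s = 1 ∧ s * galAdicCompletionMap (L := L) (IsCMField.complexConj L) hw s = u := by
  have hc1 : IsCMField.complexConj L ≠ 1 := IsCMField.complexConj_ne_one L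
  haveI : Algebra.IsQuadraticExtension ↥(maximalRealSubfield L) L := IsCMField.isQuadraticExtension L
  have hcc : IsCMField.complexConj L * IsCMField.complexConj L = 1 := AlgEquiv.ext fun x => IsCMField.complexConj_apply_apply L x
  have huO : u ∈ 𝒪[w.1.adicCompletion L] := (mem_integer_iff_valued_le_one L v w u).2 hu.le
  have huU : IsUnit (⟨u, huO⟩ : 𝒪[w.1.adicCompletion L]) :=
    (Valuation.Integers.isUnit_iff_valuation_eq_one (Valuation.integer.integers (valuation (w.1.adicCompletion L)))).2
      ((v_eq_one_iff_valuation_eq_one u).1 hu)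
  obtain ⟨s, hs⟩ := Literature.NumberTheory.LocalFields.UnramifiedQuadraticNorm.exists_mul_galAdicCompletionMap_eq_of_inert (IsCMField.complexConj L) v hc1 hcc hv w hw
    ⟨u, huO⟩ huU hσu
  have hs' : (s : w.1.adicCompletion L) * galAdicCompletionMap (L := L) (IsCMField.complexConj L) hw s = u := hs
  refine ⟨s, ?_, hs'⟩
  have hsle : Valued.v (s : w.1.adicCompletion L) ≤ 1 := (mem_integer_iff_valued_le_one L v w _).1 s.2
  have hprod : Valued.v (s : w.1.adicCompletion L) * Valued.v (s : w.1.adicCompletion L) = 1 := by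
    rw [← hu, ← hs', map_mul, valued_galAdicCompletionMap]
  refine le_antisymm hsle (not_lt.1 fun hlt => ?_)
  have : Valued.v (s : w.1.adicCompletion L) * Valued.v (s : w.1.adicCompletion L) < 1 := mul_lt_one_of_lt_of_le hlt hsle
  rw [hprod] at this
  exact lt_irrefl _ this

/-- **LEVEL `2p` at an inert place**: a `σ_w`-fixed `u_w ∈ 𝒪_w` with `u_w − 1 ∈ 2p·𝒪_w` is `s · σ_w s` with `s − 1 ∈ 2p·𝒪_w` (★ `exists_sub_one_mem_and_mul_map_eq_of_le_maximalIdeal` at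
`J = 2p·𝒪_w ≤ 𝓂_w`, trace-one element from ★ `exists_isUnit_galAdicCompletionMap_sub`). [cite: Serre1979, Ch. V §2 Prop. 3 a)] -/
theorem exists_mul_gal_eq_of_inert_of_level (hv : Algebra.IsUnramifiedIn (𝓞 L) v.asIdeal) (w : PlacesOver L v) (hw : IsCMField.complexConj L • w.1 = w.1)
    {u r : w.1.adicCompletion L} (hr : Valued.v r ≤ 1) (hur : u = 1 + twoP L v w * r)
    (hσu : galAdicCompletionMap (L := L) (IsCMField.complexConj L) hw u = u) :
    ∃ s r' : w.1.adicCompletion L, Valued.v r' ≤ 1 ∧ s = 1 + twoP L v w * r' ∧ s * galAdicCompletionMap (L := L) (IsCMField.complexConj L) hw s = u := by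
  have hc1 : IsCMField.complexConj L ≠ 1 := IsCMField.complexConj_ne_one L
  haveI : Algebra.IsQuadraticExtension ↥(maximalRealSubfield L) L := IsCMField.isQuadraticExtension L
  have hcc : IsCMField.complexConj L * IsCMField.complexConj L = 1 := AlgEquiv.ext fun x => IsCMField.complexConj_apply_apply L x
  set σ := galAdicCompletionMap (L := L) (IsCMField.complexConj L) hw with hσ
  have hσσ : ∀ x, σ (σ x) = x := Literature.NumberTheory.Automorphic.Liu2021.galAdicCompletionMap_galAdicCompletionMap_self ↥(maximalRealSubfield L) L
    (IsCMField.complexConj L) hcc hw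
  have hσO : ∀ x : 𝒪[w.1.adicCompletion L], σ x ∈ 𝒪[w.1.adicCompletion L] := mem_integer_galAdicCompletionMap (IsCMField.complexConj L) v w hw
  -- `2p ∈ 𝒪_w`, a non-unit
  have h2pO : twoP L v w ∈ 𝒪[w.1.adicCompletion L] := by
    rw [twoP, Pi.natCast_apply]; exact natCast_mem _ _
  have h2plt : Valued.v (twoP L v w) < 1 := by
    rw [twoP, Pi.natCast_apply, Nat.cast_mul, map_mul, mul_comm]
    have h2 : Valued.v ((2 : ℕ) : w.1.adicCompletion L) ≤ 1 := (mem_integer_iff_valued_le_one L v w _).1 (natCast_mem _ _)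
    exact mul_lt_one_of_lt_of_le (valued_natCast_resChar_lt_one L v w) h2
  set J : Ideal 𝒪[w.1.adicCompletion L] := Ideal.span {⟨twoP L v w, h2pO⟩} with hJ
  have hJle : J ≤ 𝓂[w.1.adicCompletion L] := by
    rw [hJ, Ideal.span_le, Set.singleton_subset_iff, SetLike.mem_coe, IsLocalRing.mem_maximalIdeal, mem_nonunits_iff]
    intro hU
    have h1 := (Valuation.Integers.isUnit_iff_valuation_eq_one (Valuation.integer.integers (valuation (w.1.adicCompletion L)))).1 hU
    exact h2plt.ne ((v_eq_one_iff_valuation_eq_one _).2 h1)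
  have hσ2p : σ (twoP L v w) = twoP L v w := by rw [twoP, Pi.natCast_apply, map_natCast]
  have hσJ : ∀ a : 𝒪[w.1.adicCompletion L], a ∈ J → (⟨σ a, hσO a⟩ : 𝒪[w.1.adicCompletion L]) ∈ J := by
    intro a ha
    rw [hJ, Ideal.mem_span_singleton'] at ha ⊢
    obtain ⟨b, hb⟩ := ha
    refine ⟨⟨σ b, hσO b⟩, Subtype.ext ?_⟩
    have hb' := congrArg Subtype.val hb
    simp only [Subring.coe_mul] at hb'
    show σ b * twoP L v w = σ a
    rw [← hb', map_mul, hσ2p]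
  have huO : u ∈ 𝒪[w.1.adicCompletion L] := by
    rw [hur]; exact add_mem (one_mem _) (mul_mem h2pO ((mem_integer_iff_valued_le_one L v w r).2 hr))
  have hu1 : (⟨u, huO⟩ : 𝒪[w.1.adicCompletion L]) - 1 ∈ J := by
    rw [hJ, Ideal.mem_span_singleton']
    refine ⟨⟨r, (mem_integer_iff_valued_le_one L v w r).2 hr⟩, Subtype.ext ?_⟩
    show r * twoP L v w = u - 1
    rw [hur, add_sub_cancel_left, mul_comm]
  obtain ⟨s, hs1, hs⟩ := Literature.NumberTheory.LocalFields.UnramifiedQuadraticNorm.exists_sub_one_mem_and_mul_map_eq_of_le_maximalIdeal σ hσσ hσO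
    (exists_isUnit_galAdicCompletionMap_sub (IsCMField.complexConj L) v hc1 hv w hw) J hJle hσJ ⟨u, huO⟩ hσu hu1
  rw [hJ, Ideal.mem_span_singleton'] at hs1
  obtain ⟨r', hr'⟩ := hs1
  refine ⟨s, r', (mem_integer_iff_valued_le_one L v w _).1 r'.2, ?_, hs⟩
  have h := congrArg Subtype.val hr'
  simp only [Subring.coe_mul] at h
  have h' : (r' : w.1.adicCompletion L) * twoP L v w = s - 1 := h
  rw [mul_comm] at h'
  rw [h', add_sub_cancel]

/-! ## §2 Assembly over `E_v = Π_{w ∣ v} L_w`: inert factors from §1, split pairs by an orientation -/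

/-- **LEVEL 0: every `c ⊗ 1`-fixed integral unit of `E_v` is a norm of an integral unit** — `u = λ · (c ⊗ 1)λ` with `|λ_w|_w = 1` at every `w ∣ v` (`v` unramified in `L`).
[cite: Serre1979, Ch. V §2 Corollary] [cite: PlatonovRapinchuk1994, §5.1] -/
theorem exists_mul_conjLocal_eq_of_valued_eq_one (hv : Algebra.IsUnramifiedIn (𝓞 L) v.asIdeal) {u : LocalRing L v}
    (hσu : conjLocal L (IsCMField.complexConj L) v u = u) (hu : ∀ w : PlacesOver L v, Valued.v (u w) = 1) :
    ∃ lam : LocalRing L v, (∀ w : PlacesOver L v, Valued.v (lam w) = 1) ∧ lam * conjLocal L (IsCMField.complexConj L) v lam = u := by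
  classical
  have hc1 : IsCMField.complexConj L ≠ 1 := IsCMField.complexConj_ne_one L
  haveI : Algebra.IsQuadraticExtension ↥(maximalRealSubfield L) L := IsCMField.isQuadraticExtension L
  -- an orientation of the places over `v`
  obtain ⟨f, hf⟩ : ∃ f : PlacesOver L v → ℕ, Function.Injective f :=
    ⟨fun w => (Fintype.equivFin (PlacesOver L v) w : ℕ), fun a b h => (Fintype.equivFin _).injective (Fin.ext h)⟩
  -- inert factors
  have hin : ∀ w : PlacesOver L v, ∀ hw : IsCMField.complexConj L • w.1 = w.1,
      ∃ s : w.1.adicCompletion L, Valued.v s = 1 ∧ s * galAdicCompletionMap (L := L) (IsCMField.complexConj L) hw s = u w := fun w hw =>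
    exists_mul_gal_eq_of_inert L v hv w hw (hu w) (by rw [← conjLocal_apply_eq_of_smul_eq (IsCMField.complexConj L) hc1 v w hw u, hσu])
  let lam : LocalRing L v := fun w =>
    if hw : IsCMField.complexConj L • w.1 = w.1 then Classical.choose (hin w hw)
    else if f w < f (PlacesOver.galInv (IsCMField.complexConj L) w) then u w else 1
  have hgi : ∀ w : PlacesOver L v, PlacesOver.galInv (IsCMField.complexConj L) (PlacesOver.galInv (IsCMField.complexConj L) w) = w :=
    fun w => PlacesOver.galInv_galInv (IsCMField.complexConj L) hc1 w
  refine ⟨lam, fun w => ?_, funext fun w => ?_⟩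
  · -- `|λ_w| = 1`
    by_cases hw : IsCMField.complexConj L • w.1 = w.1
    · simp only [lam, dif_pos hw]; exact (Classical.choose_spec (hin w hw)).1
    · simp only [lam, dif_neg hw]
      split_ifs
      · exact hu w
      · exact map_one _
  · -- `(λ · σλ)_w = u_w`
    rw [Pi.mul_apply]
    by_cases hw : IsCMField.complexConj L • w.1 = w.1
    · rw [conjLocal_apply_eq_of_smul_eq (IsCMField.complexConj L) hc1 v w hw lam]
      simp only [lam, dif_pos hw]
      exact (Classical.choose_spec (hin w hw)).2
    · have hw' : ¬ IsCMField.complexConj L • (PlacesOver.galInv (IsCMField.complexConj L) w).1 = (PlacesOver.galInv (IsCMField.complexConj L) w).1 :=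
        smul_galInv_ne L v w hw
      have hne : f w ≠ f (PlacesOver.galInv (IsCMField.complexConj L) w) := fun h => PlacesOver.galInv_ne (IsCMField.complexConj L) w hw (hf h).symm
      rw [conjLocal_apply]
      change lam w * galAdicCompletionMap (IsCMField.complexConj L) _ (lam (PlacesOver.galInv (IsCMField.complexConj L) w)) = u w
      by_cases hlt : f w < f (PlacesOver.galInv (IsCMField.complexConj L) w)
      · have hlam : lam w = u w := by simp only [lam, dif_neg hw, if_pos hlt]
        have hlam' : lam (PlacesOver.galInv (IsCMField.complexConj L) w) = 1 := by
          have h2 : ¬ f (PlacesOver.galInv (IsCMField.complexConj L) w) < f (PlacesOver.galInv (IsCMField.complexConj L) (PlacesOver.galInv (IsCMField.complexConj L) w)) := by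
            rw [hgi]; exact fun h => lt_asymm hlt h
          simp only [lam, dif_neg hw', if_neg h2]
        rw [hlam, hlam', map_one, mul_one]
      · have hgt : f (PlacesOver.galInv (IsCMField.complexConj L) w) < f w := lt_of_le_of_ne (not_lt.1 hlt) (Ne.symm hne)
        have hlam : lam w = 1 := by simp only [lam, dif_neg hw, if_neg hlt]
        have hlam' : lam (PlacesOver.galInv (IsCMField.complexConj L) w) = u (PlacesOver.galInv (IsCMField.complexConj L) w) := by
          have h2 : f (PlacesOver.galInv (IsCMField.complexConj L) w) < f (PlacesOver.galInv (IsCMField.complexConj L) (PlacesOver.galInv (IsCMField.complexConj L) w)) := by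
            rw [hgi]; exact hgt
          simp only [lam, dif_neg hw', if_pos h2]
        rw [hlam, hlam', one_mul]
        have h := conjLocal_apply L (IsCMField.complexConj L) v u w
        rw [hσu] at h
        exact h.symm

/-- **LEVEL `2p`: every `c ⊗ 1`-fixed `u ∈ 𝒪_{E_v}` with `u ≡ 1 (2p)` is a norm `λ · (c ⊗ 1)λ` of some integral `λ ≡ 1 (2p)`** (`v` unramified in `L`).
[cite: Serre1979, Ch. V §2 Prop. 3 a)] [cite: PlatonovRapinchuk1994, §5.1] -/
theorem exists_mul_conjLocal_eq_of_level (hv : Algebra.IsUnramifiedIn (𝓞 L) v.asIdeal) {u r : LocalRing L v}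
    (hσu : conjLocal L (IsCMField.complexConj L) v u = u) (hr : r ∈ localIntegers L v) (hur : u = 1 + twoP L v * r) :
    ∃ lam r' : LocalRing L v, r' ∈ localIntegers L v ∧ lam = 1 + twoP L v * r' ∧ lam * conjLocal L (IsCMField.complexConj L) v lam = u := by
  classical
  have hc1 : IsCMField.complexConj L ≠ 1 := IsCMField.complexConj_ne_one L
  haveI : Algebra.IsQuadraticExtension ↥(maximalRealSubfield L) L := IsCMField.isQuadraticExtension L
  obtain ⟨f, hf⟩ : ∃ f : PlacesOver L v → ℕ, Function.Injective f :=
    ⟨fun w => (Fintype.equivFin (PlacesOver L v) w : ℕ), fun a b h => (Fintype.equivFin _).injective (Fin.ext h)⟩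
  have hrw : ∀ w : PlacesOver L v, Valued.v (r w) ≤ 1 := fun w => (mem_integer_iff_valued_le_one L v w _).1 ((mem_localIntegers_iff L v r).1 hr w)
  have hurw : ∀ w : PlacesOver L v, u w = 1 + twoP L v w * r w := fun w => by rw [hur]; rfl
  have hin : ∀ w : PlacesOver L v, ∀ hw : IsCMField.complexConj L • w.1 = w.1,
      ∃ s r' : w.1.adicCompletion L, Valued.v r' ≤ 1 ∧ s = 1 + twoP L v w * r' ∧ s * galAdicCompletionMap (L := L) (IsCMField.complexConj L) hw s = u w :=
    fun w hw => exists_mul_gal_eq_of_inert_of_level L v hv w hw (hrw w) (hurw w)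
      (by rw [← conjLocal_apply_eq_of_smul_eq (IsCMField.complexConj L) hc1 v w hw u, hσu])
  let lam : LocalRing L v := fun w =>
    if hw : IsCMField.complexConj L • w.1 = w.1 then Classical.choose (hin w hw)
    else if f w < f (PlacesOver.galInv (IsCMField.complexConj L) w) then u w else 1
  let r' : LocalRing L v := fun w =>
    if hw : IsCMField.complexConj L • w.1 = w.1 then Classical.choose (Classical.choose_spec (hin w hw))
    else if f w < f (PlacesOver.galInv (IsCMField.complexConj L) w) then r w else 0
  have hgi : ∀ w : PlacesOver L v, PlacesOver.galInv (IsCMField.complexConj L) (PlacesOver.galInv (IsCMField.complexConj L) w) = w :=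
    fun w => PlacesOver.galInv_galInv (IsCMField.complexConj L) hc1 w
  refine ⟨lam, r', (mem_localIntegers_iff L v _).2 fun w => (mem_integer_iff_valued_le_one L v w _).2 ?_, funext fun w => ?_, funext fun w => ?_⟩
  · -- `r'` integral
    by_cases hw : IsCMField.complexConj L • w.1 = w.1
    · simp only [r', dif_pos hw]; exact (Classical.choose_spec (Classical.choose_spec (hin w hw))).1
    · simp only [r', dif_neg hw]
      split_ifs
      · exact hrw w
      · rw [map_zero]; exact zero_le
  · -- `λ = 1 + 2p r'`
    rw [Pi.add_apply, Pi.mul_apply, Pi.one_apply]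
    by_cases hw : IsCMField.complexConj L • w.1 = w.1
    · simp only [lam, r', dif_pos hw]; exact (Classical.choose_spec (Classical.choose_spec (hin w hw))).2.1
    · simp only [lam, r', dif_neg hw]
      split_ifs
      · exact hurw w
      · rw [mul_zero, add_zero]
  · -- `(λ · σλ)_w = u_w`
    rw [Pi.mul_apply]
    by_cases hw : IsCMField.complexConj L • w.1 = w.1
    · rw [conjLocal_apply_eq_of_smul_eq (IsCMField.complexConj L) hc1 v w hw lam]
      simp only [lam, dif_pos hw]
      exact (Classical.choose_spec (Classical.choose_spec (hin w hw))).2.2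
    · have hw' : ¬ IsCMField.complexConj L • (PlacesOver.galInv (IsCMField.complexConj L) w).1 = (PlacesOver.galInv (IsCMField.complexConj L) w).1 :=
        smul_galInv_ne L v w hw
      have hne : f w ≠ f (PlacesOver.galInv (IsCMField.complexConj L) w) := fun h => PlacesOver.galInv_ne (IsCMField.complexConj L) w hw (hf h).symm
      rw [conjLocal_apply]
      change lam w * galAdicCompletionMap (IsCMField.complexConj L) _ (lam (PlacesOver.galInv (IsCMField.complexConj L) w)) = u w
      by_cases hlt : f w < f (PlacesOver.galInv (IsCMField.complexConj L) w)
      · have hlam : lam w = u w := by simp only [lam, dif_neg hw, if_pos hlt]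
        have hlam' : lam (PlacesOver.galInv (IsCMField.complexConj L) w) = 1 := by
          have h2 : ¬ f (PlacesOver.galInv (IsCMField.complexConj L) w) < f (PlacesOver.galInv (IsCMField.complexConj L) (PlacesOver.galInv (IsCMField.complexConj L) w)) := by
            rw [hgi]; exact fun h => lt_asymm hlt h
          simp only [lam, dif_neg hw', if_neg h2]
        rw [hlam, hlam', map_one, mul_one]
      · have hgt : f (PlacesOver.galInv (IsCMField.complexConj L) w) < f w := lt_of_le_of_ne (not_lt.1 hlt) (Ne.symm hne)
        have hlam : lam w = 1 := by simp only [lam, dif_neg hw, if_neg hlt]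
        have hlam' : lam (PlacesOver.galInv (IsCMField.complexConj L) w) = u (PlacesOver.galInv (IsCMField.complexConj L) w) := by
          have h2 : f (PlacesOver.galInv (IsCMField.complexConj L) w) < f (PlacesOver.galInv (IsCMField.complexConj L) (PlacesOver.galInv (IsCMField.complexConj L) w)) := by
            rw [hgi]; exact hgt
          simp only [lam, dif_neg hw', if_pos h2]
        rw [hlam, hlam', one_mul]
        have h := conjLocal_apply L (IsCMField.complexConj L) v u w
        rw [hσu] at h
        exact h.symm

end Summit.HodgeConjecture.HodgeConjecture.Cruxes.H413.K2E5QuatLocalNormSurjective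

end
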